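import Literature.MathematicalPhysics.QuantumFieldTheory.Balaban1983to89.Beta.RemainderOriginTowerPlaquetteLocalSup

/-!
# T. Bałaban, *The variational problem and background fields in renormalization group method for lattice gauge theories*, Commun. Math. Phys. **102** (1985)
# 277–309 [Balaban1985Variational] (182) p. 307, (190) p. 308, (129) p. 297, read against [Balaban1985BackgroundPropagators] (3.126) p. 420, (3.132)–(3.133)
# p. 422, (3.134)–(3.137) pp. 422–423 and [Balaban1984PropagatorsII] (1.103) p. 36 ∕ Prop. 1.2: **NODE D OF ROW (D4) AT THE ORIGIN AT ZERO BACKGROUND ON THE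
# TOWER — EVERY ANALYTIC LETTER DISCHARGED** — «Y13a» `Beta.RemainderOriginTowerPlaquetteLocalSup.exists_ineq190_origin_tower_plaquette_localSup` AT THE
# FLAT CONFIGURATION `U = 1`: the three windows hold with `α = 0`, Bałaban's `Δ⁽²⁾(1) = 0` (the current `J` of the flat field vanishes, (3.134)), so the
# (3.137) display holds with `λ₀ = 0` and both smallnesses are `0 < 1`; what is left under the `∀` is the diagonal, the weights, the period, the consumer's
# display ∕ witness of `Δ_{a,k}(1)`, geometry and rates («Y15», this lineage gen 114)

CITATION HEADER (lean-in-tree rule 2026-08-18).  Audit cell `pub-balaban`, BINDER row (D4) (`RemainderConst` leaves for Bałaban's split), OWNER lineage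
`b2b-balaban-beta-an4`, gen 114.  Loci as in «Y13a» ∕ «Y12f» ∕ «Y12b» (this lineage): [Balaban1985Variational] (B11 = [15]; held
`paper:balaban1985-cmp102-variational-background`, journal page = PDF page + 276) (129)–(131) pp. 297–298, (180) p. 306, (182) p. 307, (190) p. 308;
[Balaban1985BackgroundPropagators] (B9 = [5]; `paper:balaban1985-cmp99-background-propagators`, journal page = PDF page + 388) Thm 3.1 (3.42) p. 397, Thm 3.3
p. 399, Thm 3.11 p. 416, (3.35)–(3.37) p. 396, (3.126) p. 420, (3.132)–(3.133) p. 422, (3.134)–(3.137) pp. 422–423 (at `U = 1` the current `J = 0`, hence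
`Δ⁽²⁾ = 0` by (3.134)); [Balaban1984PropagatorsII] (B6 = [3]) (1.103) p. 36 (the operator `H_k = G′_kQ_k*(Q_kG′_kQ_k*)⁻¹` at zero field), (2.51)–(2.52)
p. 232, Lemma 2.1 (2.61) p. 234; [Balaban1985Averaging] (B7 = [4]) Prop. 2 (52)–(54) p. 26, (122) p. 36.  Composed BY NAME: «Y13a» §4; `B9Eq310DeltaPrime.plaqHolU_one`.
Nothing of print is asserted here.

WHY THIS FILE («Y15»).  The ENDs of NODE D at the origin («Y12f» ∕ «Y13a») display, under the `∀`: print's three windows for a unitary background `U`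
with `0 ≤ α ≤ α⋆`, the consumer's regularity display ∕ positivity witness, geometry and rates, `Δ⁽²⁾`'s (3.137) sentence and the two smallnesses.  AT THE
FLAT CONFIGURATION `U = 1` every analytic letter is DISCHARGED: the windows hold with `α = 0` (`‖1 − 1‖ = 0`, `plaqHolU 1 = 1`), `1 ∈ unitaryUnits`,
and Bałaban's `Δ⁽²⁾(1) = 0` (the current of the flat field vanishes), so «Y13a»'s (3.137) display is met by `Δ⁽²⁾ := 0`, `λ₀ := 0`, `r_D := 0`, the
derived constants collapse (`q = q_I = θ_P = θ_D = 0 < 1`, `B_{G′} = B`, `B_{I′} = A′`) and the (182) derivative at the origin is `H₀ = H₁,k(1)` alone.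
**`exists_ineq190_origin_tower_flat`**: `∃ (B, δ, A′, r₁)` FIRST; for every height on the diagonal, weights, period, EVERY admissible display
`(αU, hα1, hαL, hU1, hreg)` and witness `hpos` of `Δ_{a,k}(1)`, every geometry and rates: `G′ = Δ_{a,k}(1)⁻¹` and `(Q_kG′Q_k†)⁻¹` CONSTRUCTED two-sided,
and `∀ δ′, δ′∕8 ≤ ρ → Ineq190 S^{coarse}_m S^{fine}_m (H₁,k(1))ᵉ↾ℝ A₀ δ′` with `A₀ = B·(M†eK_d(1))·e^{δ}·A′·c₀(1,σ)^d` — the (190) value line for [3]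
(1.103)'s `H_k` on the tower at zero background, with NO displayed analytic letter (memo §9 R7's «honest instance at zero background of NODE D», here
on NE9's tower carriers).

HONEST SCOPE.  [folklore] bookkeeping: ONE application of «Y13a» §4 at `U := 1`, `α := 0`, `Δ⁽²⁾ := 0`, `λ₀ := 0` + `simp` clean-up of the vanished
`Δ⁽²⁾` terms; NO estimate of [5], [15], [3] or [4] is proved here.  This is NODE D at the origin for the FLAT background only — a MODEL instance on the
one-domain tower `Ω_k = T_η` (value line; the divergence ∕ slice-gradient lines follow the same way from «Y13b»∕«Y13c»), NOT Bałaban's instance in a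
background field, NOT the multi-level `{Ω_j}` case, NOT (189), NOT the `Data190` plumbing; the consumer's display ∕ witness of `Δ_{a,k}(1)` stays
universally quantified (admissible ones EXIST: «Y12a» `letters_of_windows`, `B9Thm311LaplaceAkPositiveDiagonal`); the Hilbert-structure letters, `a, a′`,
`A_Q` stay before the `∃`.  Row (D4) class UNCHANGED (instance 0∕1; critical-path width 0 = NODE O; D4 DISCHARGE NO DATE); NOT B12 Thm 2, NOT BetaPertH,
NOT continuum, NOT Clay.  HONEST DEPENDENCY (cell line): continuum YM on T⁴ ⇐ BetaPertH ∧ nine spine estimates (0/9 proved); BetaPertH ⇐ (D1) ∧ (D4) ∧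
CAP+tail; G-an2-4 gates asym, D1 and NE2/3/4.  NEW file; nothing modified; 0 `def`; standard axioms; no `sorry`; `maxHeartbeats 400000` on the one theorem
(as «Y13a»).  Net new unproved facts: 0.
-/

noncomputable section

open scoped BigOperators InnerProductSpace ComplexConjugate

namespace Literature.MathematicalPhysics.QuantumFieldTheory.Balaban1983to89.Beta.RemainderOriginTowerFlat

open B11SectG B11SupSize190
open B4Sect5Torus (TSite tdist tdist_nonneg)
open B4Sect5Proof (latticeConst)
open B5TorusCover (UT)
open B9Thm34Ext (toB6)
open B9Thm37GlueTorus (torusGeom tdist1)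
open B9SectCLatticeCarrier (Bond bpos unshift)
open B9Eq311L2Pairing (WL2)
open B9Eq319QprimeTorus (blockCoord)
open B9Eq315QTower (towerP UlevOf)
open B9Eq315QTorus (perCfg perCfg_apply cornerSite)
open B9Eq316TowerFlatIsOneStep (siteCast towerP_eq_fineP_pow)
open B7Prop1Explicit (U1 Wcx boxVec)
open B7Prop2Explicit (c2' unitaryUnits)
open B9Eq310DeltaPrime (plaqHolU plaqHolU_one)
open B11Eq103H1Complex (SiteL2K BondL2K)
open B9Eq326OperatorTower (laplaceAk QkW G1k H1k)
open Beta.RemainderOriginTowerPlaquetteLocalSup (exists_ineq190_origin_tower_plaquette_localSup)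

section Tower

variable {d : ℕ} (hd : 1 ≤ d) (L : ℕ) [NeZero L] (hL : 1 ≤ L) (hL3 : 3 ≤ L)
  {𝔸 : Type*} [CStarAlgebra 𝔸] [Nontrivial 𝔸]
  {W : Type} [NormedAddCommGroup W] [InnerProductSpace ℂ W] [FiniteDimensional ℂ W] (φ : W ≃ₗ[ℂ] 𝔸)
  {Mφ Mφ' : ℝ} (hMφ : 0 ≤ Mφ) (hMφ' : 0 ≤ Mφ') (hφ : ∀ w, ‖φ w‖ ≤ Mφ * ‖w‖) (hφ' : ∀ X, ‖φ.symm X‖ ≤ Mφ' * ‖X‖)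
  {a : ℝ} (ha : 0 < a) {a' : ℝ} (ha' : 0 < a')
  (τ : 𝔸 →ₗ[ℂ] ℂ) {Cτ : ℝ} (hτ : ∀ X, ‖τ X‖ ≤ Cτ * ‖X‖) (hCτ : 0 ≤ Cτ) {Mτ : ℝ} (hτm : ∀ X Y : 𝔸, ‖τ (X * Y)‖ ≤ Mτ * ‖X‖ * ‖Y‖) (hMτ : 0 ≤ Mτ)
  {ρw : ℝ} (hρw : 0 ≤ ρw)
  (hτ₁ : ∀ X : 𝔸, τ (star X) = conj (τ X)) (hτ₂ : ∀ X Y : 𝔸, τ (X * Y) = τ (Y * X)) (hφτ : ∀ X Y : 𝔸, ⟪φ.symm X, φ.symm Y⟫_ℂ = τ (star X * Y))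
  (AQ : ℝ) (hAQ16 : 16 * ((d : ℝ) + 1) * ((d : ℝ) + 4) * c2' d L ≤ AQ)

set_option maxHeartbeats 400000 in
include hd hL hL3 hMφ hMφ' hφ hφ' ha ha' hτ hCτ hτm hMτ hρw hτ₁ hτ₂ hφτ hAQ16 in
/-- **NODE D OF ROW (D4) AT THE ORIGIN AT ZERO BACKGROUND ON THE TOWER — EVERY ANALYTIC LETTER DISCHARGED** («Y13a»
`exists_ineq190_origin_tower_plaquette_localSup` at `U := 1`, `α := 0`, `Δ⁽²⁾ := 0`, `λ₀ := 0`): `∃ (B, δ, A′, r₁)` FIRST; then for every height on the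
diagonal, weights, period, every admissible display `(αU, hα1, hαL, hU1, hreg)` and positivity witness `hpos` of `Δ_{a,k}(1)`, every geometry and rates
(`σ > 0`, `ρ + 5σ ≤ δ∕d`, `ρ + 5σ ≤ r₁∕d`, `c = c₀(1,σ)^d`) and `A₀` bound to its closed form: `G′ = Δ_{a,k}(1)⁻¹` and `(Q_kG′Q_k†)⁻¹` CONSTRUCTED two-sided and
`∀ δ′, δ′∕8 ≤ ρ → Ineq190 S^{coarse}_m S^{fine}_m (H₁,k(1))ᵉ↾ℝ A₀ δ′` — the (190) value line of [15]'s `(δ∕δB)𝓗(0) = H₀` for [3] (1.103)'s `H_k` on the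
tower at zero background.  Mechanism: the windows at `α = 0` (`sub_self`, `plaqHolU_one`), `one_mem`, the (3.137) display at `Δ⁽²⁾ = 0` with `λ₀ = 0`,
the constants by `ring`∕`simp`, then `simp only [comp_zero, zero_comp, restrictScalars_zero, map_zero, sub_zero, add_zero]` on «Y13a»'s conclusion.
[cite: Balaban1985Variational, (182) p.307, (190) p.308, (129)–(131) pp.297–298] [cite: Balaban1985BackgroundPropagators, (3.126) p.420, (3.132)–(3.133) p.422,
(3.134) p.422, (3.137) p.423, Thm 3.11 p.416] [cite: Balaban1984PropagatorsII, (1.103) p.36, (2.51)–(2.52) p.232, Lemma 2.1 (2.61) p.234]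
[cite: Balaban1985Averaging, Prop. 2 (52)–(54) p.26, (122) p.36] -/
theorem exists_ineq190_origin_tower_flat :
    ∃ B δ A' r₁ : ℝ, 0 ≤ B ∧ 0 < δ ∧ 0 ≤ A' ∧ 0 < r₁ ∧
      ∀ (n : ℕ) (η : ℝ) (_hηL : η * (L : ℝ) ^ (n + 1) = 1) (c₀ c₁ : ℝ) [Fact (0 < c₀)] [Fact (0 < c₁)]
        (_hw : c₀ * ((L : ℝ) ^ (n + 1)) ^ d = c₁) (_hρ : |η| ^ d / c₀ ≤ ρw) (m : Fin d → ℕ) [∀ i, NeZero (m i)] (_hm : ∀ i, 1 ≤ m i)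
        -- the consumer's OWN regularity display, onto-threshold and positivity witness of `Δ_{a,k}(1)` (ANY admissible ones):
        (αU : ℕ → ℝ) (hα1 : ∀ j, αU j ≤ 1 / 64) (hαL : ∀ j, 50 * (d + 1) * αU j * (L : ℝ) ^ d ≤ 1 / 2)
        (hU1 : ∀ (j : ℕ) (x : B7Prop1Explicit.Site d) (k : Fin d), perCfg (towerP L m (j + 1)) (UlevOf L m (n + 1) (fun _ => 1) j) x k ∈ U1 𝔸)
        (hreg : ∀ (j : ℕ) (y : TSite d (towerP L m j)) (k : Fin d) (ρ' : Fin d → Fin L),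
          ‖((Wcx L (perCfg (towerP L m (j + 1)) (UlevOf L m (n + 1) (fun _ => 1) j)) (cornerSite L y) k (boxVec L ρ') : 𝔸ˣ) : 𝔸) - 1‖ ≤ αU j)
        (hpos : ∀ x : BondL2K ℂ d (towerP L m (n + 1)) c₀ W, x ≠ 0 →
          0 < RCLike.re ⟪x, laplaceAk L m n φ η (fun _ => 1) hL αU hα1 hU1 hreg τ (c₀ := c₀) (c₁ := c₁) a x⟫_ℂ)
        (η₀ L₀ M₀ R : ℝ) (H : Prop)
        -- the rates and the (free) row-sum constant
        (ρ σ c : ℝ) (_hσ : 0 < σ) (_hρ0 : 0 ≤ ρ) (_hρ₁ : ρ + 5 * σ ≤ δ / d) (_hρI : ρ + 5 * σ ≤ r₁ / d) (_hc_def : c = B6.c0 1 σ ^ d)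
    -- the one derived constant of the conclusion, bound to its closed form (instantiate with `rfl`)
    {A₀ : ℝ}
    (hA₀ : A₀ = B * ((Mφ' * Real.exp (100 * d * (d + 1) * (L : ℝ) ^ d * AQ) * Mφ * ((2 * d : ℕ) : ℝ)) * Real.exp 1 *
      latticeConst d 1) * Real.exp δ * A' * c),
    ∃ (G' : (Bond d (towerP L m (n + 1)) → W) →L[ℂ] (Bond d (towerP L m (n + 1)) → W))
      (Inv' : (Bond d m → W) →L[ℂ] (Bond d m → W)),
      -- `G′ = Δ_{a,k}(1)⁻¹`, two-sided
      G' * (LinearMap.toContinuousLinearMap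
          ((WL2.linearEquiv ℂ ℂ (fun _ : Bond d (towerP L m (n + 1)) => c₀) :
              BondL2K ℂ d (towerP L m (n + 1)) c₀ W ≃ₗ[ℂ] (Bond d (towerP L m (n + 1)) → W)).toLinearMap ∘ₗ
            laplaceAk L m n φ η (fun _ => 1) hL αU hα1 hU1 hreg τ (c₀ := c₀) (c₁ := c₁) a ∘ₗ
            (WL2.linearEquiv ℂ ℂ (fun _ : Bond d (towerP L m (n + 1)) => c₀) :
              BondL2K ℂ d (towerP L m (n + 1)) c₀ W ≃ₗ[ℂ] (Bond d (towerP L m (n + 1)) → W)).symm.toLinearMap)) = 1 ∧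
      (LinearMap.toContinuousLinearMap
          ((WL2.linearEquiv ℂ ℂ (fun _ : Bond d (towerP L m (n + 1)) => c₀) :
              BondL2K ℂ d (towerP L m (n + 1)) c₀ W ≃ₗ[ℂ] (Bond d (towerP L m (n + 1)) → W)).toLinearMap ∘ₗ
            laplaceAk L m n φ η (fun _ => 1) hL αU hα1 hU1 hreg τ (c₀ := c₀) (c₁ := c₁) a ∘ₗ
            (WL2.linearEquiv ℂ ℂ (fun _ : Bond d (towerP L m (n + 1)) => c₀) :
              BondL2K ℂ d (towerP L m (n + 1)) c₀ W ≃ₗ[ℂ] (Bond d (towerP L m (n + 1)) → W)).symm.toLinearMap)) * G' = 1 ∧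
      -- `Inv′ = (Q_kG′Q_k†)⁻¹`, two-sided
      Inv' * ((LinearMap.toContinuousLinearMap
          ((WL2.linearEquiv ℂ ℂ (fun _ : Bond d m => c₁) : BondL2K ℂ d m c₁ W ≃ₗ[ℂ] (Bond d m → W)).toLinearMap ∘ₗ
            QkW L m n φ (fun _ => 1) hL αU hα1 hU1 hreg (c₀ := c₀) (c₁ := c₁) ∘ₗ
            (WL2.linearEquiv ℂ ℂ (fun _ : Bond d (towerP L m (n + 1)) => c₀) :
              BondL2K ℂ d (towerP L m (n + 1)) c₀ W ≃ₗ[ℂ] (Bond d (towerP L m (n + 1)) → W)).symm.toLinearMap)).comp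
        (G'.comp (LinearMap.toContinuousLinearMap
          ((WL2.linearEquiv ℂ ℂ (fun _ : Bond d (towerP L m (n + 1)) => c₀) :
              BondL2K ℂ d (towerP L m (n + 1)) c₀ W ≃ₗ[ℂ] (Bond d (towerP L m (n + 1)) → W)).toLinearMap ∘ₗ
            LinearMap.adjoint (QkW L m n φ (fun _ => 1) hL αU hα1 hU1 hreg (c₀ := c₀) (c₁ := c₁)) ∘ₗ
            (WL2.linearEquiv ℂ ℂ (fun _ : Bond d m => c₁) : BondL2K ℂ d m c₁ W ≃ₗ[ℂ] (Bond d m → W)).symm.toLinearMap)))) = 1 ∧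
      ((LinearMap.toContinuousLinearMap
          ((WL2.linearEquiv ℂ ℂ (fun _ : Bond d m => c₁) : BondL2K ℂ d m c₁ W ≃ₗ[ℂ] (Bond d m → W)).toLinearMap ∘ₗ
            QkW L m n φ (fun _ => 1) hL αU hα1 hU1 hreg (c₀ := c₀) (c₁ := c₁) ∘ₗ
            (WL2.linearEquiv ℂ ℂ (fun _ : Bond d (towerP L m (n + 1)) => c₀) :
              BondL2K ℂ d (towerP L m (n + 1)) c₀ W ≃ₗ[ℂ] (Bond d (towerP L m (n + 1)) → W)).symm.toLinearMap)).comp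
        (G'.comp (LinearMap.toContinuousLinearMap
          ((WL2.linearEquiv ℂ ℂ (fun _ : Bond d (towerP L m (n + 1)) => c₀) :
              BondL2K ℂ d (towerP L m (n + 1)) c₀ W ≃ₗ[ℂ] (Bond d (towerP L m (n + 1)) → W)).toLinearMap ∘ₗ
            LinearMap.adjoint (QkW L m n φ (fun _ => 1) hL αU hα1 hU1 hreg (c₀ := c₀) (c₁ := c₁)) ∘ₗ
            (WL2.linearEquiv ℂ ℂ (fun _ : Bond d m => c₁) : BondL2K ℂ d m c₁ W ≃ₗ[ℂ] (Bond d m → W)).symm.toLinearMap)))) * Inv' = 1 ∧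
      -- the (190) letter of `(δ/δB)𝓗(0) = H₀ = H₁,k(1)` AT ZERO BACKGROUND (`Δ⁽²⁾ = 0`), by name
      ∀ δ' : ℝ, δ' / 8 ≤ ρ →
        Ineq190
          (supSize (toB6 (torusGeom m η₀ L₀ M₀) R H)
            (fun y => Finset.univ.filter fun c : Bond d m => bpos c = UT.toSite m y)
            (fun c => UT.ofSite m (bpos c)) : BlockNorm (toB6 (torusGeom m η₀ L₀ M₀) R H) (Bond d m → W))
          (supSize (toB6 (torusGeom m η₀ L₀ M₀) R H)
            (fun y => Finset.univ.filter fun b : Bond d (towerP L m (n + 1)) =>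
              blockCoord (L ^ (n + 1)) m (siteCast (towerP_eq_fineP_pow L m (n + 1)) (bpos b)) = UT.toSite m y)
            (fun b => UT.ofSite m (blockCoord (L ^ (n + 1)) m (siteCast (towerP_eq_fineP_pow L m (n + 1)) (bpos b)))) :
              BlockNorm (toB6 (torusGeom m η₀ L₀ M₀) R H) (Bond d (towerP L m (n + 1)) → W))
          (((WL2.linearEquiv ℂ ℂ (fun _ : Bond d (towerP L m (n + 1)) => c₀) :
                  BondL2K ℂ d (towerP L m (n + 1)) c₀ W ≃ₗ[ℂ] (Bond d (towerP L m (n + 1)) → W)).toLinearMap ∘ₗ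
              H1k L m n φ η (fun _ => 1) hL αU hα1 hU1 hreg τ (c₀ := c₀) (c₁ := c₁) hαL hpos ∘ₗ
              (WL2.linearEquiv ℂ ℂ (fun _ : Bond d m => c₁) : BondL2K ℂ d m c₁ W ≃ₗ[ℂ] (Bond d m → W)).symm.toLinearMap).restrictScalars ℝ)
          A₀ δ' := by
  obtain ⟨αs, B, δ, A', r₁, hαs, hB, hδ, hA', hr₁, HY⟩ :=
    exists_ineq190_origin_tower_plaquette_localSup hd L hL hL3 φ hMφ hMφ' hφ hφ' ha ha' τ hτ hCτ hτm hMτ hρw hτ₁ hτ₂ hφτ AQ hAQ16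
  refine ⟨B, δ, A', r₁, hB, hδ, hA', hr₁, ?_⟩
  intro n η hηL c₀ c₁ _ _ hw hρ m _ hm αU hα1 hαL hU1 hreg hpos η₀ L₀ M₀ R H ρ σ c hσ hρ0 hρ₁ hρI hc_def A₀ hA₀
  -- the flat background: unitary, and print's three windows with `α = 0`
  have hUu : ∀ b : Bond d (towerP L m (n + 1)), ((fun _ => (1 : 𝔸ˣ)) b) ∈ unitaryUnits 𝔸 := fun _ => Subgroup.one_mem _
  have hUη : ∀ b : Bond d (towerP L m (n + 1)), ‖(((fun _ => (1 : 𝔸ˣ)) b : 𝔸ˣ) : 𝔸) - 1‖ ≤ 0 * η := fun _ => by simp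
  have hpl : ∀ p : B9SectCLatticeCarrier.Plaq d (towerP L m (n + 1)), ‖(plaqHolU (fun _ => (1 : 𝔸ˣ)) p : 𝔸) - 1‖ ≤ 0 * η ^ 2 := fun p => by
    rw [plaqHolU_one]; simp
  have hUgrad : ∀ (x : TSite d (towerP L m (n + 1))) (μ : Fin d),
      ‖(((fun _ => (1 : 𝔸ˣ)) (x, μ) : 𝔸ˣ) : 𝔸) - ((fun _ => (1 : 𝔸ˣ)) (unshift μ x, μ) : 𝔸ˣ)‖ ≤ 0 * η ^ 2 := fun _ _ => by simp
  -- `Δ⁽²⁾(1) = 0`: the (3.137) display with `λ₀ = 0`, `r_D = 0`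
  have hD2 : ∀ (A : Bond d (towerP L m (n + 1)) → W) (b : Bond d (towerP L m (n + 1))) (F : ℝ), 0 ≤ F →
      (∀ b' : Bond d (towerP L m (n + 1)),
        tdist1 m (UT.ofSite m (blockCoord (L ^ (n + 1)) m (siteCast (towerP_eq_fineP_pow L m (n + 1)) (bpos b))))
          (UT.ofSite m (blockCoord (L ^ (n + 1)) m (siteCast (towerP_eq_fineP_pow L m (n + 1)) (bpos b')))) ≤ 0 → ‖A b'‖ ≤ F) →
      ‖((WL2.linearEquiv ℂ ℂ (fun _ : Bond d (towerP L m (n + 1)) => c₀) :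
            BondL2K ℂ d (towerP L m (n + 1)) c₀ W ≃ₗ[ℂ] (Bond d (towerP L m (n + 1)) → W)).toLinearMap ∘ₗ
          (0 : BondL2K ℂ d (towerP L m (n + 1)) c₀ W →ₗ[ℂ] BondL2K ℂ d (towerP L m (n + 1)) c₀ W) ∘ₗ
          (WL2.linearEquiv ℂ ℂ (fun _ : Bond d (towerP L m (n + 1)) => c₀) :
            BondL2K ℂ d (towerP L m (n + 1)) c₀ W ≃ₗ[ℂ] (Bond d (towerP L m (n + 1)) → W)).symm.toLinearMap) A b‖ ≤ 0 * F := by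
    intro A b F _ _
    simp
  -- «Y13a» at `U := 1`, `α := 0`, `Δ⁽²⁾ := 0`, `λ₀ := 0`, `r_D := 0`; every derived constant at its closed form
  have h := HY n η hηL c₀ c₁ hw hρ m hm (fun _ => 1) hUu 0 le_rfl hαs.le hUη hpl hUgrad αU hα1 hαL hU1 hreg hpos η₀ L₀ M₀ R H ρ σ c hσ hρ0 hρ₁ hρI hc_def
    0 (lam₀ := 0) (rD := 0) le_rfl hD2
    (q := 0) (BG' := B) (θP := 0) (qI := 0) (BI' := A') (A₀ := A₀) (θD := 0)
    (BGt := B + ((Mφ' * Mφ * Real.exp (50 * (d + 1) * AQ)) * Real.exp 1 * latticeConst d 1) *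
      ((Mφ' * Real.exp (100 * d * (d + 1) * (L : ℝ) ^ d * AQ) * Mφ * ((2 * d : ℕ) : ℝ)) * Real.exp 1 * latticeConst d 1) *
      A' * B * B * Real.exp ((ρ + 2 * σ) * d) * Real.exp ((ρ + 2 * σ) * d) * c * c)
    (by ring) zero_lt_one (by simp) (by ring) (by ring) zero_lt_one (by simp) hA₀ (by ring) (by simp)
  obtain ⟨G', Inv', h1, h2, h3, h4, h5⟩ := h
  refine ⟨G', Inv', ?_, ?_, h3, h4, fun δ' hδ' => ?_⟩
  · simpa only [LinearMap.comp_zero, LinearMap.zero_comp, map_zero, sub_zero] using h1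
  · simpa only [LinearMap.comp_zero, LinearMap.zero_comp, map_zero, sub_zero] using h2
  · have h6 := h5 δ' hδ'
    simp only [LinearMap.comp_zero, LinearMap.zero_comp, LinearMap.restrictScalars_zero, add_zero, mul_zero, zero_mul] at h6
    exact h6

end Tower

end Literature.MathematicalPhysics.QuantumFieldTheory.Balaban1983to89.Beta.RemainderOriginTowerFlat

end
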